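/-
Copyright (c) 2026 the pub-hodgecm-mathlib formalisation cell (harness21).  Prover seat hodgecm-mathlib-LH3-p02 (g5): line LH3 (closer stub `stub_N9`), LETTER L3′,
organ (S-lin) «`I^st_c(jcH)` and the stable-orbital image are ℂ-linear» — brick #1 of the SURJ-OF-FORWARD road (RULING #22; binder of record LH10-p01 (g5);
LH3-plan (g4) DEAL 2026-09-02T12:32:50Z).  PART B: the orbital side.
-/
import Literature.NumberTheory.Rogawski1990.ArchBouazizStableFamily               -- ★ p849717 (D2-P3): `stOrbFamH`, `stOrbFamH_of_mem_regS`, `stOrbFamH_zero_of_mem_regS`; ★ (T-MEAS) `chartOrbH`, `chartOrbH_def`; ★ `flipSet_mem_regS_iff`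
import Literature.NumberTheory.Automorphic.ArchEndoscopicChartOrbitalContinuity   -- ★ p849873 `uniformlyProper_endoTorus`; brings ★ `continuousOn_integral_descConj_of_uniformlyProper` toolkit, ★ `continuous_descConj` (`Literature.MeasureTheory.Group`)
import Literature.NumberTheory.Rogawski1990.ArchSmoothAmbientLift                 -- ★ `ArchSmooth₂` (via ★ `ArchimedeanTransfer`), `ArchSmooth₂.continuous`, `ArchSmooth₂.hasCompactSupport`, `archSmooth₂_zero`, ★ `mem_archSmooth_iff`
import HarnessLib

/-!
# (S-lin), PART B: THE STABLE-ORBITAL IMAGE IS ℂ-LINEAR — `fH ↦ stOrbFamH νH fH` is additive and homogeneous on the regular sets, `C_c^∞(H_∞)` is a subspace, so the families that ARE stable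
# orbital families of `C_c^∞` functions form a ℂ-linear space (Bouaziz 1994 §3.1 `J_G` linear, §6.2, Thm. 6.2.1 (i); Shelstad 1979 §4; Deitmar–Echterhoff Lemma 9.3.3)

Topic `NumberTheory/Rogawski1990`; namespace `Literature.NumberTheory.Rogawski1990`.  THEOREMS ONLY (no `def`, no instance, no notation, no axiom, no named fact, no `sorry`).
Cell `pub/hodgecm-mathlib`, crux H413 (`stmt-HodgeConjecture-24833`), F0∕P3c line LH3 (closer stub `stub_N9`, leaf `F0_P3c_StubN9Direct`), LETTER L3′ `stub_N9bouazizSurjective`,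
split «FORWARD ⊕ SURJ-OF-FORWARD» (RULING #22): organ `BouazizSurjOfForwardStatement` (binder of record LH10-p01 (g5)), whose conclusion `∃ fH, ArchSmooth₂ L fH ∧ ∀ S, EqOn (stOrbFamH L νH fH S)
(Ψ S) (RegS S)` is shown here to be ADDITIVE ∕ HOMOGENEOUS ∕ FINITELY ADDITIVE in `Ψ` — so the surjectivity may be proved piece by piece (partition of unity, subtraction of the regular-set
part).  Brick **(S-lin)** (LH3-plan (g4) DEAL 12:32:50Z → LH3-p02 (g5)), part B; part A = ★ `ArchBouazizSpaceLinear` (the space side).  Count-neutral.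

WHAT IS PROVED.
* §5a generic (`Literature.MeasureTheory.Group` tokens ★ `descConj`): **`integrable_descConj_of_proper`** — at an element `γ` where conjugation is proper modulo `M` (every `y` with `yγy⁻¹`
  in a compact `C` has its coset in one compact `𝒦`) the quotient orbital integrand of every `a ∈ C_c(G, E)` is INTEGRABLE for every measure on `G ⧸ M` finite on compacts (continuous,
  supported in `𝒦`, strongly measurable by Mathlib `Continuous.stronglyMeasurable_of_support_subset_isCompact` — no separation axiom on `G ⧸ M` —, bounded, integrable on `𝒦`); the
  (HYP)-form `integrable_descConj_of_uniformlyProper` (the binder of ★ `continuousOn_integral_descConj_of_uniformlyProper`, read at the compact `{x}`); `descConj_add ∕ _const_smul ∕ _neg ∕ _sum`.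
* §5b **`integrable_descConj_endoTorus_of_mem_regS`** (★ `uniformlyProper_endoTorus`), **`chartOrbH_add_of_mem_regS`** (`fH, gH ∈ C_c(H_∞)`, `c ∈ RegS S`), `chartOrbH_const_smul`, `chartOrbH_neg`
  (every `c`), `chartOrbH_finset_sum_of_mem_regS`; **`stOrbFamH_add_of_mem_regS`**, `stOrbFamH_const_smul_of_mem_regS`, `stOrbFamH_neg_of_mem_regS`, `stOrbFamH_finset_sum_of_mem_regS` (on `RegS S`,
  where the letter reads the families — the literal reading ★ `stOrbFamH_of_mem_regS`; every flip of a regular point is regular, `flipSet_mem_regS_of_mem_powerset` over ★ `flipSet_mem_regS_iff`).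
* §6 `ArchSmooth₂.add ∕ .neg ∕ .finset_sum` (★ `archSmooth` is a submodule, ★ `mem_archSmooth_iff`; `.smul` is ★ `ArchSmooth₂.smul` of `ArchCentralValueTransferRayScaling`, not restated) and
  THE IMAGE IS LINEAR: **`exists_archSmooth₂_stOrbFamH_eqOn_add ∕ _smul ∕ _sub ∕ _finset_sum`**; and the SURJ assembly's (Σ-ADD) socket `StOrbFamHSumStatement` (LH10-p01 (g5)
  skeleton v3) token for token: **`archSmooth₂_sum_and_stOrbFamH_sum_eqOn_regS (νH) (n) (fHs) (h : ∀ i, ArchSmooth₂ L (fHs i)) : ArchSmooth₂ L (∑ i, fHs i) ∧ ∀ S, EqOn (stOrbFamH L νH (∑ i, fHs i) S)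
  (fun c => ∑ i, stOrbFamH L νH (fHs i) S c) (RegS S)`**.
HONEST LABEL: no surjectivity is claimed here; HC_CM is proved only modulo the 7 printed citations (2 remaining: hLiu418 = `stmt-HodgeConjecture-24832`, h413 =
`stmt-HodgeConjecture-24833`) until rung 0 closes; this file is count-neutral.

## References
* [Bouaziz1994IntegralesOrbitales] A. Bouaziz, *Intégrales orbitales sur les groupes de Lie réductifs*, Ann. Sci. ÉNS 27 (1994) 573–609, §3.1 p. 579 (`J_G` linear), §6.2 p. 591, Thm. 6.2.1 (i)
  p. 592.
* [Shelstad1979] D. Shelstad, *Characters and inner forms of a quasi-split group over ℝ*, Compositio Math. 39 (1979), §4 p. 22 (`Φ^T_f`, `Ψ^T_f`).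
* [DeitmarEchterhoff2014] A. Deitmar, S. Echterhoff, *Principles of Harmonic Analysis*, 2nd ed. (2014), Lemma 9.3.3, Thm. 1.5.3 (quotient integral).
* [Rogawski1990] J. D. Rogawski, *Automorphic Representations of Unitary Groups in Three Variables*, Ann. of Math. Stud. 123 (1990), §4.1 (4.1.1) p. 39, §8.3 p. 122, §14.3 p. 234.
* [BorelJacquet1979] A. Borel, H. Jacquet, *Automorphic forms and automorphic representations*, Proc. Symp. Pure Math. 33.1 (1979), §4.1.
-/

set_option autoImplicit false

noncomputable section

open Set Filter Topology Complex Function Real MeasureTheory MeasureTheory.Measure NumberField NumberField.InfinitePlace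
open scoped ContDiff Classical
open Literature.NumberTheory.Automorphic Literature.NumberTheory.Automorphic.UnitaryGroup Literature.NumberTheory.Automorphic.ArchCartan
open Literature.MeasureTheory.Group

namespace Literature.NumberTheory.Rogawski1990

/-! ## §5 The orbital side: integrability of the quotient orbital integrand, and linearity of `chartOrbH` ∕ `stOrbFamH` on the regular sets -/

section Generic

variable {G : Type*} [Group G] [TopologicalSpace G] [IsTopologicalGroup G] {E : Type*} [NormedAddCommGroup E]

/-- **PROPERNESS MODULO `M` AT ONE ELEMENT ⇒ INTEGRABILITY of the quotient orbital integrand of every `a ∈ C_c(G, E)`** for EVERY measure on `G ⧸ M` finite on compact sets: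
if every `y` with `y γ y⁻¹ ∈ C` (`C` compact) has its coset in one compact `𝒦 ⊆ G ⧸ M`, the integrand `ȳ ↦ a(y γ y⁻¹)` is continuous, vanishes off the compact `𝒦` attached to
`C = tsupport a`, hence is strongly measurable (Mathlib `Continuous.stronglyMeasurable_of_support_subset_isCompact` — no separation axiom on `G ⧸ M` needed), bounded, and integrable on
`𝒦`.  The pointwise integrability twin of ★ `continuousOn_integral_descConj_of_uniformlyProper`. [cite: DeitmarEchterhoff2014, Lemma 9.3.3; Thm. 1.5.3] -/
theorem integrable_descConj_of_proper (M : Subgroup G) (γ : G) (hcomm : ∀ m ∈ M, m * γ = γ * m)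
    (hprop : ∀ C : Set G, IsCompact C → ∃ 𝒦 : Set (G ⧸ M), IsCompact 𝒦 ∧ ∀ y : G, y * γ * y⁻¹ ∈ C → (QuotientGroup.mk y : G ⧸ M) ∈ 𝒦)
    [MeasurableSpace (G ⧸ M)] [OpensMeasurableSpace (G ⧸ M)] (μ : Measure (G ⧸ M)) [IsFiniteMeasureOnCompacts μ]
    {a : G → E} (ha : Continuous a) (hac : HasCompactSupport a) : Integrable (descConj γ M hcomm a) μ := by
  obtain ⟨𝒦, h𝒦, hmem⟩ := hprop (tsupport a) hac.isCompact
  have hF : Continuous (descConj γ M hcomm a) := continuous_descConj γ M hcomm ha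
  have hzero : ∀ q : G ⧸ M, q ∉ 𝒦 → descConj γ M hcomm a q = 0 := by
    intro q hq
    induction q using QuotientGroup.induction_on with
    | H y =>
      rw [descConj_mk]
      by_contra hne
      exact hq (hmem y (subset_tsupport _ (Function.mem_support.2 hne)))
  have hsupp : support (descConj γ M hcomm a) ⊆ 𝒦 := fun q hq => by
    by_contra h
    exact hq (hzero q h)
  have hSM : StronglyMeasurable (descConj γ M hcomm a) := hF.stronglyMeasurable_of_support_subset_isCompact h𝒦 hsupp
  obtain ⟨C, hC⟩ := h𝒦.exists_bound_of_continuousOn hF.continuousOn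
  have hbd : ∀ q, ‖descConj γ M hcomm a q‖ ≤ max C 0 := fun q => by
    by_cases hq : q ∈ 𝒦
    · exact (hC q hq).trans (le_max_left _ _)
    · rw [hzero q hq, norm_zero]
      exact le_max_right _ _
  have hon : IntegrableOn (descConj γ M hcomm a) 𝒦 μ :=
    Integrable.mono' (integrableOn_const h𝒦.measure_ne_top) hSM.aestronglyMeasurable (Eventually.of_forall fun q => hbd q)
  exact hon.integrable_of_forall_notMem_eq_zero hzero

/-- **Uniform properness on a set `S ∋ x` ⇒ integrability at `x`** (the (HYP) binder of ★ `continuousOn_integral_descConj_of_uniformlyProper`, read at the compact `{x}`).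
[cite: DeitmarEchterhoff2014, Lemma 9.3.3] -/
theorem integrable_descConj_of_uniformlyProper {X : Type*} [TopologicalSpace X] (M : Subgroup G) {c : X → G} (hcomm : ∀ x, ∀ m ∈ M, m * c x = c x * m)
    {S : Set X} (hprop : ∀ K ⊆ S, IsCompact K → ∀ C : Set G, IsCompact C →
      ∃ 𝒦 : Set (G ⧸ M), IsCompact 𝒦 ∧ ∀ x ∈ K, ∀ y : G, y * c x * y⁻¹ ∈ C → (QuotientGroup.mk y : G ⧸ M) ∈ 𝒦)
    [MeasurableSpace (G ⧸ M)] [OpensMeasurableSpace (G ⧸ M)] (μ : Measure (G ⧸ M)) [IsFiniteMeasureOnCompacts μ]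
    {a : G → E} (ha : Continuous a) (hac : HasCompactSupport a) {x : X} (hx : x ∈ S) : Integrable (descConj (c x) M (hcomm x) a) μ := by
  refine integrable_descConj_of_proper M (c x) (hcomm x) (fun C hC => ?_) μ ha hac
  obtain ⟨𝒦, h𝒦, hmem⟩ := hprop {x} (singleton_subset_iff.2 hx) isCompact_singleton C hC
  exact ⟨𝒦, h𝒦, fun y hy => hmem x (mem_singleton x) y hy⟩

omit [TopologicalSpace G] [IsTopologicalGroup G] in
/-- The quotient orbital integrand is additive in the test function (definitional on cosets). [cite: DeitmarEchterhoff2014, Thm. 1.5.3] -/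
theorem descConj_add {α : Type*} [Add α] (M : Subgroup G) (γ : G) (hcomm : ∀ m ∈ M, m * γ = γ * m) (a b : G → α) :
    descConj γ M hcomm (a + b) = descConj γ M hcomm a + descConj γ M hcomm b := by
  funext q
  induction q using QuotientGroup.induction_on with
  | H y => rfl

omit [TopologicalSpace G] [IsTopologicalGroup G] in
/-- The quotient orbital integrand is homogeneous in the test function. [cite: DeitmarEchterhoff2014, Thm. 1.5.3] -/
theorem descConj_const_smul {R α : Type*} [SMul R α] (M : Subgroup G) (γ : G) (hcomm : ∀ m ∈ M, m * γ = γ * m) (r : R) (a : G → α) :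
    descConj γ M hcomm (r • a) = r • descConj γ M hcomm a := by
  funext q
  induction q using QuotientGroup.induction_on with
  | H y => rfl

omit [TopologicalSpace G] [IsTopologicalGroup G] in
/-- The quotient orbital integrand is additive over finite sums of test functions. [cite: DeitmarEchterhoff2014, Thm. 1.5.3] -/
theorem descConj_sum {α : Type*} [AddCommMonoid α] {ι : Type*} (M : Subgroup G) (γ : G) (hcomm : ∀ m ∈ M, m * γ = γ * m) (s : Finset ι) (a : ι → G → α) :
    descConj γ M hcomm (∑ i ∈ s, a i) = ∑ i ∈ s, descConj γ M hcomm (a i) := by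
  funext q
  induction q using QuotientGroup.induction_on with
  | H y => rw [Finset.sum_apply, descConj_mk, Finset.sum_apply]; rfl

omit [TopologicalSpace G] [IsTopologicalGroup G] in
/-- The quotient orbital integrand is odd in the test function. [cite: DeitmarEchterhoff2014, Thm. 1.5.3] -/
theorem descConj_neg {α : Type*} [Neg α] (M : Subgroup G) (γ : G) (hcomm : ∀ m ∈ M, m * γ = γ * m) (a : G → α) :
    descConj γ M hcomm (-a) = -descConj γ M hcomm a := by
  funext q
  induction q using QuotientGroup.induction_on with
  | H y => rfl

end Generic

section Orbital

variable (L : Type) [Field L] [NumberField L] [IsCMField L]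

omit [IsCMField L] in
/-- A flip of compact places inside `univ ∖ S` keeps a regular chart point regular (★ `flipSet_mem_regS_iff`). [cite: Shelstad1979, §4 p. 22] -/
theorem flipSet_mem_regS_of_mem_powerset (S : Finset {w : InfinitePlace L // IsComplex w}) {T : Finset {w : InfinitePlace L // IsComplex w}} (hT : T ∈ (Finset.univ \ S).powerset)
    {c : {w : InfinitePlace L // IsComplex w} → Fin 3 → ℝ} (hc : c ∈ RegS S) : flipSet T c ∈ RegS S :=
  (flipSet_mem_regS_iff S (fun _ hw => (Finset.mem_sdiff.1 (Finset.mem_powerset.1 hT hw)).2) c).2 hc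

variable
  [MeasurableSpace (↥(arch (↥(maximalRealSubfield L)) L (IsCMField.complexConj L) 2 (Matrix.of fun i j : Fin 2 => if i.val + j.val + 1 = 2 then (1 : L) else 0)) ×
      ↥(arch (↥(maximalRealSubfield L)) L (IsCMField.complexConj L) 1 (Matrix.of fun i j : Fin 1 => if i.val + j.val + 1 = 1 then (1 : L) else 0)))]
  [BorelSpace (↥(arch (↥(maximalRealSubfield L)) L (IsCMField.complexConj L) 2 (Matrix.of fun i j : Fin 2 => if i.val + j.val + 1 = 2 then (1 : L) else 0)) ×
      ↥(arch (↥(maximalRealSubfield L)) L (IsCMField.complexConj L) 1 (Matrix.of fun i j : Fin 1 => if i.val + j.val + 1 = 1 then (1 : L) else 0)))]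
  (νH : Measure (↥(arch (↥(maximalRealSubfield L)) L (IsCMField.complexConj L) 2 (Matrix.of fun i j : Fin 2 => if i.val + j.val + 1 = 2 then (1 : L) else 0)) ×
      ↥(arch (↥(maximalRealSubfield L)) L (IsCMField.complexConj L) 1 (Matrix.of fun i j : Fin 1 => if i.val + j.val + 1 = 1 then (1 : L) else 0))))
  [IsFiniteMeasureOnCompacts νH] [νH.IsMulRightInvariant]
  (S : Finset {w : InfinitePlace L // IsComplex w})

/-- **AT A REGULAR CHART POINT THE CHART ORBITAL INTEGRAND OF `fH ∈ C_c(H_∞)` IS INTEGRABLE** for the canonical quotient measure (★ `uniformlyProper_endoTorus` at the compact `{c}`;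
the quotient measure ★ `chartQuotientMeasureH` is finite on compacts). [cite: Rogawski1990, §8.3 p. 122] [cite: DeitmarEchterhoff2014, Lemma 9.3.3; Thm. 1.5.3] -/
theorem integrable_descConj_endoTorus_of_mem_regS
    {fH : ↥(arch (↥(maximalRealSubfield L)) L (IsCMField.complexConj L) 2 (Matrix.of fun i j : Fin 2 => if i.val + j.val + 1 = 2 then (1 : L) else 0)) ×
      ↥(arch (↥(maximalRealSubfield L)) L (IsCMField.complexConj L) 1 (Matrix.of fun i j : Fin 1 => if i.val + j.val + 1 = 1 then (1 : L) else 0)) → ℂ}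
    (hfH : Continuous fH) (hfHc : HasCompactSupport fH) {c : {w : InfinitePlace L // IsComplex w} → Fin 3 → ℝ} (hc : c ∈ RegS S) :
    letI : MeasurableSpace ((↥(arch (↥(maximalRealSubfield L)) L (IsCMField.complexConj L) 2 (Matrix.of fun i j : Fin 2 => if i.val + j.val + 1 = 2 then (1 : L) else 0)) ×
        ↥(arch (↥(maximalRealSubfield L)) L (IsCMField.complexConj L) 1 (Matrix.of fun i j : Fin 1 => if i.val + j.val + 1 = 1 then (1 : L) else 0))) ⧸ chartTorusH L S) := borel _
    Integrable (descConj (endoTorus L S c) (chartTorusH L S) (forall_mem_chartTorusH_comm L S c) fH) (chartQuotientMeasureH L νH S) := by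
  letI : MeasurableSpace ((↥(arch (↥(maximalRealSubfield L)) L (IsCMField.complexConj L) 2 (Matrix.of fun i j : Fin 2 => if i.val + j.val + 1 = 2 then (1 : L) else 0)) ×
      ↥(arch (↥(maximalRealSubfield L)) L (IsCMField.complexConj L) 1 (Matrix.of fun i j : Fin 1 => if i.val + j.val + 1 = 1 then (1 : L) else 0))) ⧸ chartTorusH L S) := borel _
  haveI : BorelSpace ((↥(arch (↥(maximalRealSubfield L)) L (IsCMField.complexConj L) 2 (Matrix.of fun i j : Fin 2 => if i.val + j.val + 1 = 2 then (1 : L) else 0)) ×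
      ↥(arch (↥(maximalRealSubfield L)) L (IsCMField.complexConj L) 1 (Matrix.of fun i j : Fin 1 => if i.val + j.val + 1 = 1 then (1 : L) else 0))) ⧸ chartTorusH L S) := ⟨rfl⟩
  haveI : IsFiniteMeasureOnCompacts (chartQuotientMeasureH L νH S) := by
    unfold chartQuotientMeasureH
    infer_instance
  exact integrable_descConj_of_uniformlyProper (chartTorusH L S) (forall_mem_chartTorusH_comm L S) (uniformlyProper_endoTorus L S)
    (chartQuotientMeasureH L νH S) hfH hfHc hc

/-- **`chartOrbH` IS ADDITIVE IN THE TEST FUNCTION AT REGULAR CHART POINTS** (`fH, gH ∈ C_c(H_∞)`, `c ∈ RegS S`): both quotient integrands are integrable there.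
[cite: Rogawski1990, §8.3 p. 122; §4.1 (4.1.1) p. 39] [cite: Bouaziz1994IntegralesOrbitales, §3.1 p. 579] -/
theorem chartOrbH_add_of_mem_regS
    {fH gH : ↥(arch (↥(maximalRealSubfield L)) L (IsCMField.complexConj L) 2 (Matrix.of fun i j : Fin 2 => if i.val + j.val + 1 = 2 then (1 : L) else 0)) ×
      ↥(arch (↥(maximalRealSubfield L)) L (IsCMField.complexConj L) 1 (Matrix.of fun i j : Fin 1 => if i.val + j.val + 1 = 1 then (1 : L) else 0)) → ℂ}
    (hfH : Continuous fH) (hfHc : HasCompactSupport fH) (hgH : Continuous gH) (hgHc : HasCompactSupport gH)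
    {c : {w : InfinitePlace L // IsComplex w} → Fin 3 → ℝ} (hc : c ∈ RegS S) :
    chartOrbH L νH S (fH + gH) c = chartOrbH L νH S fH c + chartOrbH L νH S gH c := by
  have hf := integrable_descConj_endoTorus_of_mem_regS L νH S hfH hfHc hc
  have hg := integrable_descConj_endoTorus_of_mem_regS L νH S hgH hgHc hc
  rw [chartOrbH_def, chartOrbH_def, chartOrbH_def, descConj_add, integral_add' hf hg, mul_add]

/-- **`chartOrbH` IS HOMOGENEOUS IN THE TEST FUNCTION** (every `c`; no integrability needed). [cite: Rogawski1990, §4.1 (4.1.1) p. 39] -/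
theorem chartOrbH_const_smul
    (fH : ↥(arch (↥(maximalRealSubfield L)) L (IsCMField.complexConj L) 2 (Matrix.of fun i j : Fin 2 => if i.val + j.val + 1 = 2 then (1 : L) else 0)) ×
      ↥(arch (↥(maximalRealSubfield L)) L (IsCMField.complexConj L) 1 (Matrix.of fun i j : Fin 1 => if i.val + j.val + 1 = 1 then (1 : L) else 0)) → ℂ)
    (a : ℂ) (c : {w : InfinitePlace L // IsComplex w} → Fin 3 → ℝ) :
    chartOrbH L νH S (a • fH) c = a * chartOrbH L νH S fH c := by
  rw [chartOrbH_def, chartOrbH_def, descConj_const_smul]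
  simp_rw [Pi.smul_apply]
  rw [integral_smul, smul_eq_mul]
  ring

/-- **`chartOrbH` IS ODD IN THE TEST FUNCTION** (every `c`). [cite: Rogawski1990, §4.1 (4.1.1) p. 39] -/
theorem chartOrbH_neg
    (fH : ↥(arch (↥(maximalRealSubfield L)) L (IsCMField.complexConj L) 2 (Matrix.of fun i j : Fin 2 => if i.val + j.val + 1 = 2 then (1 : L) else 0)) ×
      ↥(arch (↥(maximalRealSubfield L)) L (IsCMField.complexConj L) 1 (Matrix.of fun i j : Fin 1 => if i.val + j.val + 1 = 1 then (1 : L) else 0)) → ℂ)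
    (c : {w : InfinitePlace L // IsComplex w} → Fin 3 → ℝ) :
    chartOrbH L νH S (-fH) c = -chartOrbH L νH S fH c := by
  rw [chartOrbH_def, chartOrbH_def, descConj_neg, integral_neg', mul_neg]

/-- **THE STABLE ORBITAL FAMILY IS ADDITIVE IN `fH` ON THE REGULAR SETS**: `stOrbFamH νH (fH + gH) S c = stOrbFamH νH fH S c + stOrbFamH νH gH S c` for `c ∈ RegS S`
(the literal reading ★ `stOrbFamH_of_mem_regS`; every flip of `c` is regular). [cite: Shelstad1979, §4 p. 22] [cite: Bouaziz1994IntegralesOrbitales, §3.1 p. 579; §6.2 p. 591] -/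
theorem stOrbFamH_add_of_mem_regS
    {fH gH : ↥(arch (↥(maximalRealSubfield L)) L (IsCMField.complexConj L) 2 (Matrix.of fun i j : Fin 2 => if i.val + j.val + 1 = 2 then (1 : L) else 0)) ×
      ↥(arch (↥(maximalRealSubfield L)) L (IsCMField.complexConj L) 1 (Matrix.of fun i j : Fin 1 => if i.val + j.val + 1 = 1 then (1 : L) else 0)) → ℂ}
    (hfH : Continuous fH) (hfHc : HasCompactSupport fH) (hgH : Continuous gH) (hgHc : HasCompactSupport gH)
    {c : {w : InfinitePlace L // IsComplex w} → Fin 3 → ℝ} (hc : c ∈ RegS S) :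
    stOrbFamH L νH (fH + gH) S c = stOrbFamH L νH fH S c + stOrbFamH L νH gH S c := by
  rw [stOrbFamH_of_mem_regS L νH _ S hc, stOrbFamH_of_mem_regS L νH _ S hc, stOrbFamH_of_mem_regS L νH _ S hc, ← mul_add, ← Finset.sum_add_distrib]
  congr 1
  exact Finset.sum_congr rfl fun T hT => chartOrbH_add_of_mem_regS L νH S hfH hfHc hgH hgHc (flipSet_mem_regS_of_mem_powerset L S hT hc)

/-- **THE STABLE ORBITAL FAMILY IS HOMOGENEOUS IN `fH` ON THE REGULAR SETS.** [cite: Shelstad1979, §4 p. 22] [cite: Bouaziz1994IntegralesOrbitales, §6.2 p. 591] -/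
theorem stOrbFamH_const_smul_of_mem_regS
    (fH : ↥(arch (↥(maximalRealSubfield L)) L (IsCMField.complexConj L) 2 (Matrix.of fun i j : Fin 2 => if i.val + j.val + 1 = 2 then (1 : L) else 0)) ×
      ↥(arch (↥(maximalRealSubfield L)) L (IsCMField.complexConj L) 1 (Matrix.of fun i j : Fin 1 => if i.val + j.val + 1 = 1 then (1 : L) else 0)) → ℂ)
    (a : ℂ) {c : {w : InfinitePlace L // IsComplex w} → Fin 3 → ℝ} (hc : c ∈ RegS S) :
    stOrbFamH L νH (a • fH) S c = a * stOrbFamH L νH fH S c := by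
  rw [stOrbFamH_of_mem_regS L νH _ S hc, stOrbFamH_of_mem_regS L νH _ S hc]
  simp only [chartOrbH_const_smul, ← Finset.mul_sum]
  ring

/-- **THE STABLE ORBITAL FAMILY IS ODD IN `fH` ON THE REGULAR SETS.** [cite: Shelstad1979, §4 p. 22] -/
theorem stOrbFamH_neg_of_mem_regS
    (fH : ↥(arch (↥(maximalRealSubfield L)) L (IsCMField.complexConj L) 2 (Matrix.of fun i j : Fin 2 => if i.val + j.val + 1 = 2 then (1 : L) else 0)) ×
      ↥(arch (↥(maximalRealSubfield L)) L (IsCMField.complexConj L) 1 (Matrix.of fun i j : Fin 1 => if i.val + j.val + 1 = 1 then (1 : L) else 0)) → ℂ)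
    {c : {w : InfinitePlace L // IsComplex w} → Fin 3 → ℝ} (hc : c ∈ RegS S) :
    stOrbFamH L νH (-fH) S c = -stOrbFamH L νH fH S c := by
  rw [stOrbFamH_of_mem_regS L νH _ S hc, stOrbFamH_of_mem_regS L νH _ S hc]
  simp only [chartOrbH_neg, Finset.sum_neg_distrib, mul_neg]

/-- **`chartOrbH` IS ADDITIVE OVER FINITE SUMS OF TEST FUNCTIONS AT REGULAR CHART POINTS** (each quotient integrand is integrable there).
[cite: Rogawski1990, §8.3 p. 122; §4.1 (4.1.1) p. 39] -/
theorem chartOrbH_finset_sum_of_mem_regS {ι : Type*} (s : Finset ι)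
    {fH : ι → ↥(arch (↥(maximalRealSubfield L)) L (IsCMField.complexConj L) 2 (Matrix.of fun i j : Fin 2 => if i.val + j.val + 1 = 2 then (1 : L) else 0)) ×
      ↥(arch (↥(maximalRealSubfield L)) L (IsCMField.complexConj L) 1 (Matrix.of fun i j : Fin 1 => if i.val + j.val + 1 = 1 then (1 : L) else 0)) → ℂ}
    (hf : ∀ i ∈ s, Continuous (fH i)) (hfc : ∀ i ∈ s, HasCompactSupport (fH i))
    {c : {w : InfinitePlace L // IsComplex w} → Fin 3 → ℝ} (hc : c ∈ RegS S) :
    chartOrbH L νH S (∑ i ∈ s, fH i) c = ∑ i ∈ s, chartOrbH L νH S (fH i) c := by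
  have hint := fun i (hi : i ∈ s) => integrable_descConj_endoTorus_of_mem_regS L νH S (hf i hi) (hfc i hi) hc
  rw [chartOrbH_def, descConj_sum, Finset.sum_fn, integral_finsetSum s hint, Finset.mul_sum]
  exact Finset.sum_congr rfl fun i _ => (chartOrbH_def L νH S (fH i) c).symm

/-- **THE STABLE ORBITAL FAMILY IS ADDITIVE OVER FINITE SUMS OF TEST FUNCTIONS ON THE REGULAR SETS.** [cite: Shelstad1979, §4 p. 22] [cite: Bouaziz1994IntegralesOrbitales, §6.2 p. 591] -/
theorem stOrbFamH_finset_sum_of_mem_regS {ι : Type*} (s : Finset ι)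
    {fH : ι → ↥(arch (↥(maximalRealSubfield L)) L (IsCMField.complexConj L) 2 (Matrix.of fun i j : Fin 2 => if i.val + j.val + 1 = 2 then (1 : L) else 0)) ×
      ↥(arch (↥(maximalRealSubfield L)) L (IsCMField.complexConj L) 1 (Matrix.of fun i j : Fin 1 => if i.val + j.val + 1 = 1 then (1 : L) else 0)) → ℂ}
    (hf : ∀ i ∈ s, Continuous (fH i)) (hfc : ∀ i ∈ s, HasCompactSupport (fH i))
    {c : {w : InfinitePlace L // IsComplex w} → Fin 3 → ℝ} (hc : c ∈ RegS S) :
    stOrbFamH L νH (∑ i ∈ s, fH i) S c = ∑ i ∈ s, stOrbFamH L νH (fH i) S c := by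
  rw [stOrbFamH_of_mem_regS L νH _ S hc]
  have h : ∀ i ∈ s, stOrbFamH L νH (fH i) S c = archRH S c * ∑ T ∈ (Finset.univ \ S).powerset, chartOrbH L νH S (fH i) (flipSet T c) :=
    fun i _ => stOrbFamH_of_mem_regS L νH _ S hc
  rw [Finset.sum_congr rfl h, ← Finset.mul_sum, Finset.sum_comm]
  congr 1
  exact Finset.sum_congr rfl fun T hT => chartOrbH_finset_sum_of_mem_regS L νH S s hf hfc (flipSet_mem_regS_of_mem_powerset L S hT hc)

end Orbital

/-! ## §6 `C_c^∞(H_∞)` is linear and the stable-orbital IMAGE is linear -/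

section Image

variable {L : Type} [Field L] [NumberField L] [IsCMField L]

/-- **`C_c^∞(H_∞)` (★ `ArchSmooth₂`, by restriction along `ι_∞`) IS CLOSED UNDER ADDITION** (★ `archSmooth` is a submodule; continuity and compact support add).
[cite: Rogawski1990, §14.3 p. 234] [cite: BorelJacquet1979, §4.1] -/
theorem ArchSmooth₂.add
    {aH bH : ↥(arch (↥(maximalRealSubfield L)) L (IsCMField.complexConj L) 2 (Matrix.of fun i j : Fin 2 => if i.val + j.val + 1 = 2 then (1 : L) else 0)) ×
      ↥(arch (↥(maximalRealSubfield L)) L (IsCMField.complexConj L) 1 (Matrix.of fun i j : Fin 1 => if i.val + j.val + 1 = 1 then (1 : L) else 0)) → ℂ}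
    (haH : ArchSmooth₂ L aH) (hbH : ArchSmooth₂ L bH) : ArchSmooth₂ L (aH + bH) := by
  obtain ⟨φ, hφc, hφs, hφsm, hφa⟩ := haH
  obtain ⟨ψ, hψc, hψs, hψsm, hψa⟩ := hbH
  refine ⟨φ + ψ, hφc.add hψc, hφs.add hψs, ?_, fun k => ?_⟩
  · exact (mem_archSmooth_iff _ _).1 (Submodule.add_mem _ ((mem_archSmooth_iff _ _).2 hφsm) ((mem_archSmooth_iff _ _).2 hψsm))
  · simp only [Pi.add_apply, hφa k, hψa k]

/-- **`C_c^∞(H_∞)` IS CLOSED UNDER NEGATION.** [cite: Rogawski1990, §14.3 p. 234] [cite: BorelJacquet1979, §4.1] -/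
theorem ArchSmooth₂.neg
    {aH : ↥(arch (↥(maximalRealSubfield L)) L (IsCMField.complexConj L) 2 (Matrix.of fun i j : Fin 2 => if i.val + j.val + 1 = 2 then (1 : L) else 0)) ×
      ↥(arch (↥(maximalRealSubfield L)) L (IsCMField.complexConj L) 1 (Matrix.of fun i j : Fin 1 => if i.val + j.val + 1 = 1 then (1 : L) else 0)) → ℂ}
    (haH : ArchSmooth₂ L aH) : ArchSmooth₂ L (-aH) := by
  obtain ⟨φ, hφc, hφs, hφsm, hφa⟩ := haH
  refine ⟨-φ, hφc.neg, hφs.neg, ?_, fun k => ?_⟩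
  · exact (mem_archSmooth_iff _ _).1 (Submodule.neg_mem _ ((mem_archSmooth_iff _ _).2 hφsm))
  · simp only [Pi.neg_apply, hφa k]

/-- **`C_c^∞(H_∞)` IS CLOSED UNDER FINITE SUMS.** [cite: Rogawski1990, §14.3 p. 234] [cite: BorelJacquet1979, §4.1] -/
theorem ArchSmooth₂.finset_sum {ι : Type*} (s : Finset ι)
    {aH : ι → ↥(arch (↥(maximalRealSubfield L)) L (IsCMField.complexConj L) 2 (Matrix.of fun i j : Fin 2 => if i.val + j.val + 1 = 2 then (1 : L) else 0)) ×
      ↥(arch (↥(maximalRealSubfield L)) L (IsCMField.complexConj L) 1 (Matrix.of fun i j : Fin 1 => if i.val + j.val + 1 = 1 then (1 : L) else 0)) → ℂ}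
    (h : ∀ i ∈ s, ArchSmooth₂ L (aH i)) : ArchSmooth₂ L (∑ i ∈ s, aH i) := by
  classical
  induction s using Finset.induction_on with
  | empty =>
    rw [Finset.sum_empty]
    exact archSmooth₂_zero L
  | insert a s ha ih =>
    rw [Finset.sum_insert ha]
    exact (h a (Finset.mem_insert_self a s)).add (ih fun i hi => h i (Finset.mem_insert_of_mem hi))

variable
  [MeasurableSpace (↥(arch (↥(maximalRealSubfield L)) L (IsCMField.complexConj L) 2 (Matrix.of fun i j : Fin 2 => if i.val + j.val + 1 = 2 then (1 : L) else 0)) ×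
      ↥(arch (↥(maximalRealSubfield L)) L (IsCMField.complexConj L) 1 (Matrix.of fun i j : Fin 1 => if i.val + j.val + 1 = 1 then (1 : L) else 0)))]
  [BorelSpace (↥(arch (↥(maximalRealSubfield L)) L (IsCMField.complexConj L) 2 (Matrix.of fun i j : Fin 2 => if i.val + j.val + 1 = 2 then (1 : L) else 0)) ×
      ↥(arch (↥(maximalRealSubfield L)) L (IsCMField.complexConj L) 1 (Matrix.of fun i j : Fin 1 => if i.val + j.val + 1 = 1 then (1 : L) else 0)))]
  (νH : Measure (↥(arch (↥(maximalRealSubfield L)) L (IsCMField.complexConj L) 2 (Matrix.of fun i j : Fin 2 => if i.val + j.val + 1 = 2 then (1 : L) else 0)) ×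
      ↥(arch (↥(maximalRealSubfield L)) L (IsCMField.complexConj L) 1 (Matrix.of fun i j : Fin 1 => if i.val + j.val + 1 = 1 then (1 : L) else 0))))
  [IsFiniteMeasureOnCompacts νH] [νH.IsMulRightInvariant]

/-- **THE STABLE-ORBITAL IMAGE IS CLOSED UNDER ADDITION**: if `Ψ₁`, `Ψ₂` are, on every regular set `RegS S`, the stable orbital families of `C_c^∞` functions `f₁`, `f₂`, then
`Ψ₁ + Ψ₂` is that of `f₁ + f₂` there (`BouazizSurjOfForwardStatement`'s conclusion is additive in `Ψ`). [cite: Bouaziz1994IntegralesOrbitales, §3.1 p. 579; Thm. 6.2.1 (i) p. 592] -/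
theorem exists_archSmooth₂_stOrbFamH_eqOn_add
    {Ψ₁ Ψ₂ : Finset {w : InfinitePlace L // IsComplex w} → ({w : InfinitePlace L // IsComplex w} → Fin 3 → ℝ) → ℂ}
    (h₁ : ∃ fH, ArchSmooth₂ L fH ∧ ∀ S, EqOn (stOrbFamH L νH fH S) (Ψ₁ S) (RegS S))
    (h₂ : ∃ fH, ArchSmooth₂ L fH ∧ ∀ S, EqOn (stOrbFamH L νH fH S) (Ψ₂ S) (RegS S)) :
    ∃ fH, ArchSmooth₂ L fH ∧ ∀ S, EqOn (stOrbFamH L νH fH S) ((Ψ₁ + Ψ₂) S) (RegS S) := by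
  obtain ⟨f₁, hf₁, hE₁⟩ := h₁
  obtain ⟨f₂, hf₂, hE₂⟩ := h₂
  refine ⟨f₁ + f₂, hf₁.add hf₂, fun S c hc => ?_⟩
  rw [stOrbFamH_add_of_mem_regS L νH S hf₁.continuous hf₁.hasCompactSupport hf₂.continuous hf₂.hasCompactSupport hc,
    Pi.add_apply, Pi.add_apply, hE₁ S hc, hE₂ S hc]

/-- **THE STABLE-ORBITAL IMAGE IS CLOSED UNDER SCALARS** (★ `C_c^∞(H_∞)` is closed under scalars: the ambient `archSmooth` submodule).
[cite: Bouaziz1994IntegralesOrbitales, §3.1 p. 579; Thm. 6.2.1 (i) p. 592] -/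
theorem exists_archSmooth₂_stOrbFamH_eqOn_smul
    {Ψ : Finset {w : InfinitePlace L // IsComplex w} → ({w : InfinitePlace L // IsComplex w} → Fin 3 → ℝ) → ℂ}
    (h : ∃ fH, ArchSmooth₂ L fH ∧ ∀ S, EqOn (stOrbFamH L νH fH S) (Ψ S) (RegS S)) (a : ℂ) :
    ∃ fH, ArchSmooth₂ L fH ∧ ∀ S, EqOn (stOrbFamH L νH fH S) ((a • Ψ) S) (RegS S) := by
  obtain ⟨f, hf, hE⟩ := h
  have hsm : ArchSmooth₂ L (a • f) := by
    obtain ⟨φ, hφc, hφs, hφsm, hφa⟩ := hf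
    refine ⟨a • φ, hφc.const_smul a, hφs.smul_left (f := fun _ => a), ?_, fun k => ?_⟩
    · exact (mem_archSmooth_iff _ _).1 (Submodule.smul_mem _ a ((mem_archSmooth_iff _ _).2 hφsm))
    · simp only [Pi.smul_apply, hφa k]
  refine ⟨a • f, hsm, fun S c hc => ?_⟩
  rw [stOrbFamH_const_smul_of_mem_regS L νH S f a hc, Pi.smul_apply, Pi.smul_apply, smul_eq_mul, hE S hc]

/-- **THE STABLE-ORBITAL IMAGE IS CLOSED UNDER NEGATION AND SUBTRACTION.** [cite: Bouaziz1994IntegralesOrbitales, §3.1 p. 579; Thm. 6.2.1 (i) p. 592] -/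
theorem exists_archSmooth₂_stOrbFamH_eqOn_sub
    {Ψ₁ Ψ₂ : Finset {w : InfinitePlace L // IsComplex w} → ({w : InfinitePlace L // IsComplex w} → Fin 3 → ℝ) → ℂ}
    (h₁ : ∃ fH, ArchSmooth₂ L fH ∧ ∀ S, EqOn (stOrbFamH L νH fH S) (Ψ₁ S) (RegS S))
    (h₂ : ∃ fH, ArchSmooth₂ L fH ∧ ∀ S, EqOn (stOrbFamH L νH fH S) (Ψ₂ S) (RegS S)) :
    ∃ fH, ArchSmooth₂ L fH ∧ ∀ S, EqOn (stOrbFamH L νH fH S) ((Ψ₁ - Ψ₂) S) (RegS S) := by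
  obtain ⟨f₁, hf₁, hE₁⟩ := h₁
  obtain ⟨f₂, hf₂, hE₂⟩ := h₂
  refine ⟨f₁ + -f₂, hf₁.add hf₂.neg, fun S c hc => ?_⟩
  rw [stOrbFamH_add_of_mem_regS L νH S hf₁.continuous hf₁.hasCompactSupport hf₂.neg.continuous hf₂.neg.hasCompactSupport hc,
    stOrbFamH_neg_of_mem_regS L νH S f₂ hc, Pi.sub_apply, Pi.sub_apply, hE₁ S hc, hE₂ S hc, sub_eq_add_neg]

/-- **THE STABLE-ORBITAL IMAGE IS CLOSED UNDER FINITE SUMS** (patching local solutions of the surjectivity problem). [cite: Bouaziz1994IntegralesOrbitales, Thm. 6.2.1 (i) p. 592] -/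
theorem exists_archSmooth₂_stOrbFamH_eqOn_finset_sum {ι : Type*} (s : Finset ι)
    {Ψ : ι → Finset {w : InfinitePlace L // IsComplex w} → ({w : InfinitePlace L // IsComplex w} → Fin 3 → ℝ) → ℂ}
    (h : ∀ i ∈ s, ∃ fH, ArchSmooth₂ L fH ∧ ∀ S, EqOn (stOrbFamH L νH fH S) (Ψ i S) (RegS S)) :
    ∃ fH, ArchSmooth₂ L fH ∧ ∀ S, EqOn (stOrbFamH L νH fH S) ((∑ i ∈ s, Ψ i) S) (RegS S) := by
  classical
  induction s using Finset.induction_on with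
  | empty =>
    refine ⟨0, archSmooth₂_zero L, fun S c hc => ?_⟩
    rw [stOrbFamH_zero_of_mem_regS L νH S hc, Finset.sum_empty]
    rfl
  | insert a s ha ih =>
    rw [Finset.sum_insert ha]
    exact exists_archSmooth₂_stOrbFamH_eqOn_add νH (h a (Finset.mem_insert_self a s)) (ih fun i hi => h i (Finset.mem_insert_of_mem hi))

/-- **THE (Σ-ADD) SOCKET OF THE SURJ ASSEMBLY, TOKEN FOR TOKEN** (LH10-p01 (g5) skeleton v3 `StOrbFamHSumStatement`, body after the frame): for `fHs : Fin n → C_c^∞(H_∞)`, the sum is in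
`C_c^∞(H_∞)` AND its stable orbital family is the sum of the families on every regular set — so the assembly's payer line is
`fun L _ _ _ _ _ νH _ _ n fHs h => archSmooth₂_sum_and_stOrbFamH_sum_eqOn_regS νH n fHs h`. [cite: Bouaziz1994IntegralesOrbitales, §5.1 p. 588; Thm. 6.2.1 (i) p. 592] -/
theorem archSmooth₂_sum_and_stOrbFamH_sum_eqOn_regS (n : ℕ)
    (fHs : Fin n → ↥(arch (↥(maximalRealSubfield L)) L (IsCMField.complexConj L) 2 (Matrix.of fun i j : Fin 2 => if i.val + j.val + 1 = 2 then (1 : L) else 0)) ×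
      ↥(arch (↥(maximalRealSubfield L)) L (IsCMField.complexConj L) 1 (Matrix.of fun i j : Fin 1 => if i.val + j.val + 1 = 1 then (1 : L) else 0)) → ℂ)
    (h : ∀ i, ArchSmooth₂ L (fHs i)) :
    ArchSmooth₂ L (∑ i, fHs i) ∧
      ∀ S : Finset {w : InfinitePlace L // IsComplex w}, EqOn (stOrbFamH L νH (∑ i, fHs i) S) (fun c => ∑ i, stOrbFamH L νH (fHs i) S c) (RegS S) :=
  ⟨ArchSmooth₂.finset_sum Finset.univ fun i _ => h i, fun S _ hc =>
    stOrbFamH_finset_sum_of_mem_regS L νH S Finset.univ (fun i _ => (h i).continuous) (fun i _ => (h i).hasCompactSupport) hc⟩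

end Image

end Literature.NumberTheory.Rogawski1990

end
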